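import Summits.Ventures.PercRepro.SixThreeRule

/-!
# PercRepro — Lemma Λ for the soft max-trace rule at `(6, 3)` (p2, gen 6)

mine-2's `MINE2-RLS.md` §19.3: for `B` of rank `3` with `|B| ≥ 4`,  `Λ(B) = Σ_{L line of M|B} 6^{|L ∩ B| − 2}`
satisfies `Λ(B) ≤ 6^{|B| − 3} + |B| − 1`.

* `sum_choose_linesOf`: the lines of `M|B` partition the pairs of `B`, `Σ_L C(|L ∩ B|, 2) = C(|B|, 2)`;
* `card_inter_le_of_linesOf`: no line contains all of `B` (`ρ(B) = 3`);
* `six_pow_mul_choose_le`: the ratio `6^{k − 2} / C(k, 2)` is monotone in `k`;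
* `Lam_le` (Lemma Λ): a line through `|B| − 1` points gives equality (every other line of `M|B` is a pair);
  otherwise every line has `≤ |B| − 2` points and the monotone ratio closes with `C(b, 2) ≤ 6 · C(b − 2, 2)`.
-/

namespace PercRepro

namespace SixThree

open Finset ThmH

variable {α : Type*} [DecidableEq α] {M : Matroid α} [M.Finite]

/-! ### Lemma Λ -/

/-- A pair of distinct points of the ground set has rank `2` and its closure is a line (simple matroid). -/
theorem clF_pair_mem_linesOf (hs : Simple M) {B T : Finset α} (hB : B ⊆ gr M) (hT : T ⊆ B)
    (hT2 : T.card = 2) : clF M T ∈ linesOf M B ∧ T ⊆ clF M T := by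
  obtain ⟨a, b, hab, rfl⟩ := Finset.card_eq_two.1 hT2
  have hr2 : M.eRk (({a, b} : Finset α) : Set α) = 2 := by
    apply le_antisymm
    · have h := M.eRk_le_encard (({a, b} : Finset α) : Set α)
      rw [Set.encard_coe_eq_coe_finsetCard, Finset.card_pair hab] at h
      exact_mod_cast h
    · exact two_le_eRk_of_two_mem hs (hT.trans hB) (by simp) (by simp) hab
  obtain ⟨hL, hsub⟩ := clF_mem_lines (hT.trans hB) hr2
  refine ⟨?_, hsub⟩
  unfold linesOf
  rw [Finset.mem_filter]
  refine ⟨hL, ?_⟩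
  have : ({a, b} : Finset α) ⊆ clF M {a, b} ∩ B := Finset.subset_inter hsub hT
  calc 2 = ({a, b} : Finset α).card := (Finset.card_pair hab).symm
    _ ≤ (clF M {a, b} ∩ B).card := Finset.card_le_card this

/-- **The pairs of `B` are partitioned by the lines of `M|B`**: `Σ_{L ∈ linesOf B} C(|L ∩ B|, 2) = C(|B|, 2)`. -/
theorem sum_choose_linesOf (hs : Simple M) {B : Finset α} (hB : B ⊆ gr M) :
    ∑ L ∈ linesOf M B, ((L ∩ B).card).choose 2 = B.card.choose 2 := by
  classical
  have hmaps : ∀ T ∈ B.powersetCard 2, clF M T ∈ linesOf M B := by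
    intro T hT
    rw [Finset.mem_powersetCard] at hT
    exact (clF_pair_mem_linesOf hs hB hT.1 hT.2).1
  rw [← Finset.card_powersetCard 2 B, Finset.card_eq_sum_card_fiberwise hmaps]
  apply Finset.sum_congr rfl
  intro L hL
  rw [← Finset.card_powersetCard 2 (L ∩ B)]
  congr 1
  ext T
  rw [Finset.mem_filter, Finset.mem_powersetCard, Finset.mem_powersetCard]
  constructor
  · rintro ⟨hTLB, hT2⟩
    have hTB : T ⊆ B := hTLB.trans Finset.inter_subset_right
    refine ⟨⟨hTB, hT2⟩, ?_⟩
    have hL' : L ∈ lines M := (Finset.mem_filter.1 hL).1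
    have hTL : T ⊆ L := hTLB.trans Finset.inter_subset_left
    have hr2 : M.eRk (T : Set α) = 2 := eRk_eq_two_of_subset_line hs hL' hTL (by rw [hT2])
    apply Finset.coe_injective
    rw [coe_clF]
    exact closure_eq_of_subset_line hL' hTL hr2
  · rintro ⟨⟨hTB, hT2⟩, hTL⟩
    refine ⟨?_, hT2⟩
    have hsub := (clF_pair_mem_linesOf hs hB hTB hT2).2
    rw [hTL] at hsub
    exact Finset.subset_inter hsub hTB

/-- No line of `M|B` contains all of `B` when `ρ(B) = 3`: `|L ∩ B| ≤ |B| − 1`. -/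
theorem card_inter_le_of_linesOf {B L : Finset α} (hrB : M.eRk (B : Set α) = 3) (hL : L ∈ linesOf M B) :
    (L ∩ B).card + 1 ≤ B.card := by
  have hL' : L ∈ lines M := (Finset.mem_filter.1 hL).1
  by_contra h
  push Not at h
  have hBL : B ⊆ L := by
    have hle : B.card ≤ (L ∩ B).card := by omega
    have := Finset.eq_of_subset_of_card_le Finset.inter_subset_right hle
    rw [← this]; exact Finset.inter_subset_left
  have hr := M.eRk_mono (Finset.coe_subset.2 hBL)
  rw [hrB, (mem_lines.1 hL').2.2] at hr
  exact absurd hr (by decide)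

/-- `C(m + 1, 2) ≤ 3 · C(m, 2)` for `m ≥ 2`. -/
theorem choose_two_succ_le (m : ℕ) (hm : 2 ≤ m) : (m + 1).choose 2 ≤ 3 * m.choose 2 := by
  rw [choose_two_succ]
  have h : m ≤ 2 * m.choose 2 := by
    obtain ⟨n, rfl⟩ : ∃ n, m = n + 2 := ⟨m - 2, by omega⟩
    rw [Nat.choose_two_right, show n + 2 - 1 = n + 1 from rfl]
    have hev : Even ((n + 2) * (n + 1)) := by
      rw [mul_comm]; exact Nat.even_mul_succ_self (n + 1)
    rw [Nat.two_mul_div_two_of_even hev]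
    nlinarith
  omega

/-- Ratio monotonicity: `6^{k − 2} · C(m, 2) ≤ 6^{m − 2} · C(k, 2)` for `2 ≤ k ≤ m`. -/
theorem six_pow_mul_choose_le {k m : ℕ} (hk : 2 ≤ k) (hkm : k ≤ m) :
    6 ^ (k - 2) * m.choose 2 ≤ 6 ^ (m - 2) * k.choose 2 := by
  induction m, hkm using Nat.le_induction with
  | base => exact le_refl _
  | succ m hkm ih =>
    have hm2 : 2 ≤ m := hk.trans hkm
    have h1 := choose_two_succ_le m hm2
    have hpow : 6 ^ (m + 1 - 2) = 6 * 6 ^ (m - 2) := by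
      rw [show m + 1 - 2 = (m - 2) + 1 by omega, pow_succ]; ring
    rw [hpow]
    calc 6 ^ (k - 2) * (m + 1).choose 2 ≤ 6 ^ (k - 2) * (3 * m.choose 2) := Nat.mul_le_mul_left _ h1
      _ = 3 * (6 ^ (k - 2) * m.choose 2) := by ring
      _ ≤ 3 * (6 ^ (m - 2) * k.choose 2) := Nat.mul_le_mul_left _ ih
      _ ≤ 6 * 6 ^ (m - 2) * k.choose 2 := by nlinarith [Nat.zero_le (6 ^ (m - 2) * k.choose 2)]

/-- `C(b, 2) ≤ 6 · C(b − 2, 2)` for `b ≥ 5`. -/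
theorem choose_le_six_choose (b : ℕ) (hb : 5 ≤ b) : b.choose 2 ≤ 6 * (b - 2).choose 2 := by
  obtain ⟨n, rfl⟩ : ∃ n, b = n + 5 := ⟨b - 5, by omega⟩
  rw [Nat.choose_two_right, show n + 5 - 2 = n + 3 by omega, Nat.choose_two_right,
    show n + 5 - 1 = n + 4 from rfl, show n + 3 - 1 = n + 2 from rfl]
  have hev1 : Even ((n + 5) * (n + 4)) := by
    rw [mul_comm]; exact Nat.even_mul_succ_self (n + 4)
  have hev2 : Even ((n + 3) * (n + 2)) := by
    rw [mul_comm]; exact Nat.even_mul_succ_self (n + 2)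
  have e1 := Nat.two_mul_div_two_of_even hev1
  have e2 := Nat.two_mul_div_two_of_even hev2
  nlinarith [e1, e2]

/-- **Lemma Λ** (mine-2 §19.3): for `B ⊆ G` of rank `3` with `|B| ≥ 4`, `Λ(B) ≤ 6^{|B| − 3} + |B| − 1`.  A line
through `|B| − 1` points of `B` gives equality (every other line of `M|B` is a pair); otherwise every line has
`≤ |B| − 2` points and the ratio `6^{k − 2} / C(k, 2)` is monotone. -/
theorem Lam_le (hs : Simple M) {B : Finset α} (hB : B ⊆ gr M) (hrB : M.eRk (B : Set α) = 3)
    (hb : 4 ≤ B.card) : Lam M B ≤ (6 : ℚ) ^ (B.card - 3) + ((B.card : ℚ) - 1) := by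
  classical
  have hsum := sum_choose_linesOf hs hB
  by_cases hbig : ∃ L₀ ∈ linesOf M B, (L₀ ∩ B).card = B.card - 1
  · obtain ⟨L₀, hL₀, hk₀⟩ := hbig
    -- every other line of `M|B` meets `B` in exactly two points
    have hother : ∀ L ∈ (linesOf M B).erase L₀, (L ∩ B).card = 2 := by
      intro L hL
      rw [Finset.mem_erase] at hL
      obtain ⟨hne, hL⟩ := hL
      have hL2 : 2 ≤ (L ∩ B).card := (Finset.mem_filter.1 hL).2
      apply le_antisymm _ hL2
      -- `L ∩ B ⊆ (L ∩ L₀ ∩ B) ∪ (B ∖ L₀)`, `|L ∩ L₀| ≤ 1`, `|B ∖ L₀| = 1`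
      have hLL₀ : (L ∩ L₀).card ≤ 1 := by
        by_contra h
        push Not at h
        obtain ⟨a, ha, b, hb', hab⟩ := Finset.one_lt_card.1 h
        rw [Finset.mem_inter] at ha hb'
        exact hne (lines_eq_of_two_mem hs (Finset.mem_filter.1 hL).1 (Finset.mem_filter.1 hL₀).1
          ha.1 hb'.1 ha.2 hb'.2 hab)
      have hBL₀ : (B \ L₀).card = 1 := by
        have h1 := Finset.card_sdiff_add_card_inter B L₀
        rw [Finset.inter_comm, hk₀] at h1
        omega
      have hsub : L ∩ B ⊆ (L ∩ L₀) ∪ (B \ L₀) := by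
        intro y hy
        rw [Finset.mem_inter] at hy
        rw [Finset.mem_union, Finset.mem_inter, Finset.mem_sdiff]
        by_cases hyL₀ : y ∈ L₀
        · exact Or.inl ⟨hy.1, hyL₀⟩
        · exact Or.inr ⟨hy.2, hyL₀⟩
      calc (L ∩ B).card ≤ ((L ∩ L₀) ∪ (B \ L₀)).card := Finset.card_le_card hsub
        _ ≤ (L ∩ L₀).card + (B \ L₀).card := Finset.card_union_le _ _
        _ ≤ 1 + 1 := by omega
    -- split the sum at `L₀`
    unfold Lam
    rw [← Finset.add_sum_erase _ _ hL₀, hk₀, show B.card - 1 - 2 = B.card - 3 by omega]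
    apply add_le_add (le_refl _)
    have hterm : ∀ L ∈ (linesOf M B).erase L₀, (6 : ℚ) ^ ((L ∩ B).card - 2) = (((L ∩ B).card.choose 2 : ℕ) : ℚ) := by
      intro L hL
      rw [hother L hL]
      norm_num
    rw [Finset.sum_congr rfl hterm, ← Nat.cast_sum]
    -- `Σ_{L ≠ L₀} C(k_L, 2) = C(b, 2) − C(b − 1, 2) = b − 1`
    have hsplit := Finset.add_sum_erase (linesOf M B) (fun L => ((L ∩ B).card).choose 2) hL₀
    rw [hsum, hk₀] at hsplit
    have hb1 : B.card.choose 2 = (B.card - 1) + (B.card - 1).choose 2 := by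
      rw [← choose_two_succ, show B.card - 1 + 1 = B.card by omega]
    have : ∑ L ∈ (linesOf M B).erase L₀, ((L ∩ B).card).choose 2 = B.card - 1 := by omega
    rw [this]
    have h1 : (1 : ℚ) ≤ B.card := by exact_mod_cast (show 1 ≤ B.card by omega)
    rw [Nat.cast_sub (by omega)]
    norm_num
  · push Not at hbig
    -- every line of `M|B` meets `B` in `≤ |B| − 2` points
    have hsmall : ∀ L ∈ linesOf M B, (L ∩ B).card ≤ B.card - 2 := by
      intro L hL
      have h1 := card_inter_le_of_linesOf hrB hL
      have h2 := hbig L hL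
      omega
    set c := (B.card - 2).choose 2 with hc
    have hcpos : 0 < c := by
      rw [hc, Nat.choose_two_right]
      have : 2 ≤ B.card - 2 := by omega
      obtain ⟨n, hn⟩ : ∃ n, B.card - 2 = n + 2 := ⟨B.card - 4, by omega⟩
      rw [hn, show n + 2 - 1 = n + 1 by omega]
      have : 2 ≤ (n + 2) * (n + 1) := by nlinarith
      exact Nat.div_pos this (by norm_num)
    -- termwise: `6^{k−2} · c ≤ 6^{b−4} · C(k, 2)`
    have hterm : ∀ L ∈ linesOf M B, (6 : ℚ) ^ ((L ∩ B).card - 2) * (c : ℚ) ≤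
        (6 : ℚ) ^ (B.card - 4) * (((L ∩ B).card.choose 2 : ℕ) : ℚ) := by
      intro L hL
      have hk2 : 2 ≤ (L ∩ B).card := (Finset.mem_filter.1 hL).2
      have h := six_pow_mul_choose_le hk2 (hsmall L hL)
      rw [show B.card - 2 - 2 = B.card - 4 by omega] at h
      exact_mod_cast h
    have hLam : Lam M B * (c : ℚ) ≤ (6 : ℚ) ^ (B.card - 4) * ((B.card.choose 2 : ℕ) : ℚ) := by
      unfold Lam
      rw [Finset.sum_mul, ← hsum, Nat.cast_sum, Finset.mul_sum]
      exact Finset.sum_le_sum hterm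
    -- the numeric closing: `6^{b−4} · C(b, 2) ≤ c · (6^{b−3} + b − 1)`
    have hnum : (6 : ℚ) ^ (B.card - 4) * ((B.card.choose 2 : ℕ) : ℚ) ≤
        (c : ℚ) * ((6 : ℚ) ^ (B.card - 3) + ((B.card : ℚ) - 1)) := by
      rcases Nat.eq_or_lt_of_le hb with h4 | h5
      · rw [← h4, hc, ← h4, show Nat.choose 4 2 = 6 by decide, show Nat.choose (4 - 2) 2 = 1 by decide]
        norm_num
      · have h6 : B.card.choose 2 ≤ 6 * c := by rw [hc]; exact choose_le_six_choose _ h5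
        have h6' : ((B.card.choose 2 : ℕ) : ℚ) ≤ 6 * (c : ℚ) := by exact_mod_cast h6
        have hpow : (6 : ℚ) ^ (B.card - 3) = 6 * (6 : ℚ) ^ (B.card - 4) := by
          rw [show B.card - 3 = (B.card - 4) + 1 by omega, pow_succ]; ring
        have hb1 : (0 : ℚ) ≤ (B.card : ℚ) - 1 := by
          have : (1 : ℚ) ≤ B.card := by exact_mod_cast (show 1 ≤ B.card by omega)
          linarith
        have hp0 : (0 : ℚ) ≤ (6 : ℚ) ^ (B.card - 4) := by positivity
        have hc0 : (0 : ℚ) ≤ c := by positivity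
        rw [hpow]
        nlinarith [mul_le_mul_of_nonneg_left h6' hp0, mul_nonneg hc0 hb1]
    have hcpos' : (0 : ℚ) < c := by exact_mod_cast hcpos
    have := hLam.trans hnum
    rw [mul_comm (c : ℚ)] at this
    exact le_of_mul_le_mul_right this hcpos'

/-! ### The type bounds of mine-2 §19.7 Step 1 -/

/-- **The rest-type bound** (every line of `M|B` has `≤ m` points, `m ≥ 2`): `Λ(B) · C(m, 2) ≤ 6^{m − 2} · C(|B|, 2)`
(ratio monotonicity termwise, then the pair count).  For `m = |B| − 3` this is §19.7's
`Λ ≤ 6^{b−5} · C(b,2) / C(b−3,2)`. -/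
theorem Lam_mul_choose_le (hs : Simple M) {B : Finset α} (hB : B ⊆ gr M) {m : ℕ}
    (hsmall : ∀ L ∈ linesOf M B, (L ∩ B).card ≤ m) :
    Lam M B * ((m.choose 2 : ℕ) : ℚ) ≤ (6 : ℚ) ^ (m - 2) * ((B.card.choose 2 : ℕ) : ℚ) := by
  have hsum := sum_choose_linesOf hs hB
  have hterm : ∀ L ∈ linesOf M B, (6 : ℚ) ^ ((L ∩ B).card - 2) * ((m.choose 2 : ℕ) : ℚ) ≤
      (6 : ℚ) ^ (m - 2) * (((L ∩ B).card.choose 2 : ℕ) : ℚ) := by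
    intro L hL
    have hk2 : 2 ≤ (L ∩ B).card := (Finset.mem_filter.1 hL).2
    have h := six_pow_mul_choose_le hk2 (hsmall L hL)
    exact_mod_cast h
  unfold Lam
  rw [Finset.sum_mul, ← hsum, Nat.cast_sum, Finset.mul_sum]
  exact Finset.sum_le_sum hterm

/-- **The `(b − 2)`-type bound** (a line of `M|B` through `|B| − 2` points, `|B| ≥ 5`):
`Λ(B) ≤ 6^{|B| − 4} + 2|B|`.  Every other line meets `B` in `2` or `3` points (one point of the long line plus the
`≤ 2` points off it), at most one of them in `3` (it contains both off-points), and the pair count gives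
`Σ_{L ≠ L₀} C(k_L, 2) = 2|B| − 3`. -/
theorem Lam_le_of_long_line (hs : Simple M) {B L₀ : Finset α} (hB : B ⊆ gr M)
    (hb : 5 ≤ B.card) (hL₀ : L₀ ∈ linesOf M B) (hk₀ : (L₀ ∩ B).card = B.card - 2) :
    Lam M B ≤ (6 : ℚ) ^ (B.card - 4) + 2 * (B.card : ℚ) := by
  classical
  have hsum := sum_choose_linesOf hs hB
  have hL₀' : L₀ ∈ lines M := (Finset.mem_filter.1 hL₀).1
  -- the points of `B` off the long line: exactly two
  have hoff : (B \ L₀).card = 2 := by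
    have h := Finset.card_sdiff_add_card_inter B L₀
    rw [Finset.inter_comm, hk₀] at h
    omega
  -- every other line meets `B` in `2` or `3` points
  have hother : ∀ L ∈ (linesOf M B).erase L₀, (L ∩ B).card = 2 ∨ (L ∩ B).card = 3 := by
    intro L hL
    rw [Finset.mem_erase] at hL
    obtain ⟨hne, hL⟩ := hL
    have hL2 : 2 ≤ (L ∩ B).card := (Finset.mem_filter.1 hL).2
    have hLL₀ : (L ∩ L₀).card ≤ 1 := by
      by_contra h
      push Not at h
      obtain ⟨a, ha, b, hb', hab⟩ := Finset.one_lt_card.1 h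
      rw [Finset.mem_inter] at ha hb'
      exact hne (lines_eq_of_two_mem hs (Finset.mem_filter.1 hL).1 hL₀' ha.1 hb'.1 ha.2 hb'.2 hab)
    have hsub : L ∩ B ⊆ (L ∩ L₀) ∪ (B \ L₀) := by
      intro y hy
      rw [Finset.mem_inter] at hy
      rw [Finset.mem_union, Finset.mem_inter, Finset.mem_sdiff]
      by_cases hyL₀ : y ∈ L₀
      · exact Or.inl ⟨hy.1, hyL₀⟩
      · exact Or.inr ⟨hy.2, hyL₀⟩
    have hle : (L ∩ B).card ≤ 3 := by
      calc (L ∩ B).card ≤ ((L ∩ L₀) ∪ (B \ L₀)).card := Finset.card_le_card hsub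
        _ ≤ (L ∩ L₀).card + (B \ L₀).card := Finset.card_union_le _ _
        _ ≤ 1 + 2 := by omega
    omega
  -- at most one other line has `3` points of `B`: it contains both off-points
  set E₃ := ((linesOf M B).erase L₀).filter (fun L => (L ∩ B).card = 3) with hE₃
  have hE₃card : E₃.card ≤ 1 := by
    rw [Finset.card_le_one]
    intro L hL L' hL'
    rw [hE₃, Finset.mem_filter, Finset.mem_erase] at hL hL'
    -- each contains `B ∖ L₀`
    have hcontain : ∀ L ∈ E₃, B \ L₀ ⊆ L := by
      intro L hL
      rw [hE₃, Finset.mem_filter, Finset.mem_erase] at hL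
      obtain ⟨⟨hne, hLl⟩, h3⟩ := hL
      by_contra hnot
      rw [Finset.not_subset] at hnot
      obtain ⟨y, hyB, hyL⟩ := hnot
      -- then `L ∩ B ⊆ (L ∩ L₀) ∪ ((B ∖ L₀) ∖ {y})`, of size `≤ 1 + 1`
      have hLL₀ : (L ∩ L₀).card ≤ 1 := by
        by_contra h
        push Not at h
        obtain ⟨a, ha, b, hb', hab⟩ := Finset.one_lt_card.1 h
        rw [Finset.mem_inter] at ha hb'
        exact hne (lines_eq_of_two_mem hs (Finset.mem_filter.1 hLl).1 hL₀' ha.1 hb'.1 ha.2 hb'.2 hab)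
      have hsub : L ∩ B ⊆ (L ∩ L₀) ∪ ((B \ L₀).erase y) := by
        intro z hz
        rw [Finset.mem_inter] at hz
        rw [Finset.mem_union, Finset.mem_inter, Finset.mem_erase, Finset.mem_sdiff]
        by_cases hzL₀ : z ∈ L₀
        · exact Or.inl ⟨hz.1, hzL₀⟩
        · refine Or.inr ⟨?_, hz.2, hzL₀⟩
          rintro rfl
          exact hyL hz.1
      have hle : (L ∩ B).card ≤ 2 := by
        calc (L ∩ B).card ≤ ((L ∩ L₀) ∪ ((B \ L₀).erase y)).card := Finset.card_le_card hsub
          _ ≤ (L ∩ L₀).card + ((B \ L₀).erase y).card := Finset.card_union_le _ _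
          _ ≤ 1 + 1 := by
              have := Finset.card_erase_of_mem hyB
              omega
      omega
    obtain ⟨u, hu, v, hv, huv⟩ := Finset.one_lt_card.1 (show 1 < (B \ L₀).card by omega)
    have hcL := hcontain L (by rw [hE₃, Finset.mem_filter, Finset.mem_erase]; exact hL)
    have hcL' := hcontain L' (by rw [hE₃, Finset.mem_filter, Finset.mem_erase]; exact hL')
    exact lines_eq_of_two_mem hs (Finset.mem_filter.1 hL.1.2).1 (Finset.mem_filter.1 hL'.1.2).1
      (hcL hu) (hcL hv) (hcL' hu) (hcL' hv) huv
  -- the pair count over the other lines: `2|B| − 3`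
  have hsplit := Finset.add_sum_erase (linesOf M B) (fun L => ((L ∩ B).card).choose 2) hL₀
  rw [hsum, hk₀] at hsplit
  have hchoose : B.card.choose 2 = (B.card - 2).choose 2 + (2 * B.card - 3) := by
    obtain ⟨n, hn⟩ : ∃ n, B.card = n + 2 := ⟨B.card - 2, by omega⟩
    rw [hn, show n + 2 - 2 = n by omega, choose_two_succ, choose_two_succ]
    omega
  have hrest : ∑ L ∈ (linesOf M B).erase L₀, ((L ∩ B).card).choose 2 = 2 * B.card - 3 := by omega
  -- split the other lines into the `3`-lines and the `2`-lines
  have hsum3 : ∑ L ∈ (linesOf M B).erase L₀, ((L ∩ B).card).choose 2 =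
      3 * E₃.card + (((linesOf M B).erase L₀).filter (fun L => ¬ (L ∩ B).card = 3)).card := by
    rw [← Finset.sum_filter_add_sum_filter_not _ (fun L => (L ∩ B).card = 3)]
    have hA : ∑ L ∈ ((linesOf M B).erase L₀).filter (fun L => (L ∩ B).card = 3), ((L ∩ B).card).choose 2 =
        3 * E₃.card := by
      rw [hE₃, Finset.card_eq_sum_ones, Finset.mul_sum]
      apply Finset.sum_congr rfl
      intro L hL
      rw [(Finset.mem_filter.1 hL).2]
      rfl
    have hB' : ∑ L ∈ ((linesOf M B).erase L₀).filter (fun L => ¬ (L ∩ B).card = 3), ((L ∩ B).card).choose 2 =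
        (((linesOf M B).erase L₀).filter (fun L => ¬ (L ∩ B).card = 3)).card := by
      rw [Finset.card_eq_sum_ones]
      apply Finset.sum_congr rfl
      intro L hL
      rw [Finset.mem_filter] at hL
      rcases hother L hL.1 with h2 | h3
      · rw [h2]; rfl
      · exact absurd h3 hL.2
    rw [hA, hB']
  have hLam : Lam M B = (6 : ℚ) ^ (B.card - 4) + 6 * (E₃.card : ℚ) +
      ((((linesOf M B).erase L₀).filter (fun L => ¬ (L ∩ B).card = 3)).card : ℚ) := by
    unfold Lam
    rw [← Finset.add_sum_erase _ _ hL₀, hk₀, show B.card - 2 - 2 = B.card - 4 by omega,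
      ← Finset.sum_filter_add_sum_filter_not _ (fun L => (L ∩ B).card = 3)]
    rw [Finset.sum_congr rfl (fun L hL => by rw [(Finset.mem_filter.1 hL).2]; norm_num : ∀ L ∈ ((linesOf M B).erase L₀).filter (fun L => (L ∩ B).card = 3), (6 : ℚ) ^ ((L ∩ B).card - 2) = 6),
      Finset.sum_const, nsmul_eq_mul]
    have : ∑ L ∈ ((linesOf M B).erase L₀).filter (fun L => ¬ (L ∩ B).card = 3), (6 : ℚ) ^ ((L ∩ B).card - 2) =
        ∑ _L ∈ ((linesOf M B).erase L₀).filter (fun L => ¬ (L ∩ B).card = 3), (1 : ℚ) := by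
      apply Finset.sum_congr rfl
      intro L hL
      rw [Finset.mem_filter] at hL
      rcases hother L hL.1 with h2 | h3
      · rw [h2]; norm_num
      · exact absurd h3 hL.2
    rw [this, Finset.sum_const, nsmul_eq_mul, mul_one]
    ring
  rw [hLam]
  have h1 : (3 * E₃.card + (((linesOf M B).erase L₀).filter (fun L => ¬ (L ∩ B).card = 3)).card : ℚ) =
      2 * (B.card : ℚ) - 3 := by
    have := hsum3.symm.trans hrest
    have h3 : (3 : ℕ) ≤ 2 * B.card := by omega
    have hq : ((3 * E₃.card + (((linesOf M B).erase L₀).filter (fun L => ¬ (L ∩ B).card = 3)).card : ℕ) : ℚ) =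
        ((2 * B.card - 3 : ℕ) : ℚ) := by rw [this]
    push_cast [Nat.cast_sub h3] at hq
    linarith
  have hE : (E₃.card : ℚ) ≤ 1 := by exact_mod_cast hE₃card
  linarith

end SixThree

end PercRepro
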